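import Summits.NavierStokesRegularity.NavierStokesRegularity.Theorems.FilamentSkeletonRssNoExactProfileAdjointEnergy
import Summits.NavierStokesRegularity.NavierStokesRegularity.Theorems.FilamentSkeletonRssKelvinGateRotationSize
import Literature.Analysis.PDE.InteriorSupBound

/-!
# Route `FilamentSkeletonRss` · negative item `NoExactProfileNearSymmetricPair` (stmt-NavierStokesRegularity-24091) — S_γ groundwork (B9):
# L² → L^∞ for the steady vorticity equation in rotating similarity variables (second step of the interior-regularity brick (M-a))

Helper file (theorems only), `--supports stmt-NavierStokesRegularity-24091 --as helper`; LEAD of 23611 / registrar of 23920, lane ns-filament-21221-p1 g15.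

WHY.  Memo `Cruxes/TransverseReductionRJ/Lines/defect_column_gate_1AR_B2_gamma_LEAD15.md` (M-a): pointwise control of `Ω = curl U` on the tube walls / outer layer from weak
data.  Each Cartesian component `u = ⟪Ω, eᵢ⟫` of a `C³` solution of the steady vorticity equation `𝒯_UΩ = 0` satisfies the Laplacian inequality
`|Δu| ≤ ‖v‖·‖∇u‖ + |u| + (|α| + ‖DU‖)·‖Ω‖` (`v = U + ½y − αe₃×y`), which is the hypothesis of the tree's scaled interior maximum estimate
`Literature.Analysis.PDE.ball_estimates_three` (Gilbarg–Trudinger Thm 8.17 / 9.20 for smooth functions, dimension three) on every ball of radius `σ ≤ min(1, 1/sup‖v‖)`.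
Result (`vorticity_component_sq_le`): `⟪Ω(x), eᵢ⟫² ≤ K·σ·((M/σ)⁴ + (|α| + D)²)·∫_{B̄(x₀,σ)} ‖Ω‖²` on `B̄(x₀, σ/2)`, `D = sup_{B̄σ}‖DU‖`, with the universal constants of the tree lemma —
POLYNOMIAL losses in `1/σ ~ √Γ·(drift size)`, as the memo's (A2) requires.  The `L²` input is the Caccioppoli brick (B8) plus an `L²(DU)` bound from the C⁰ window data (not here).
HONEST FRAMING: groundwork on the NEGATIVE side of a HYPOTHETICAL filament-type rotating-self-similar blow-up route (MODEL rung); 24091/23611/23920 OPEN; nothing here bears on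
Navier–Stokes regularity, which is NOT proved.
-/

set_option linter.dupNamespace false

noncomputable section

namespace Summit.NavierStokesRegularity.NavierStokesRegularity.Theorems.DefectColumnGate

open scoped BigOperators Topology InnerProductSpace Laplacian ContDiff
open Set Function MeasureTheory Metric
open Literature.Analysis.FluidPDE Literature.Analysis.FluidPDE.RieszKernel
open Summit.NavierStokesRegularity.NavierStokesRegularity.Theorems.KelvinGate

/-- **Cauchy–Schwarz in coordinates**: for a scalar `u` and any `w`, `|Du(x)[w]| ≤ ‖w‖·√(Σⱼ (Du(x)[eⱼ])²)` (standard basis of `ℝ³`). -/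
theorem abs_fderiv_apply_le_norm_mul_sqrt {u : EuclideanSpace ℝ (Fin 3) → ℝ} (x w : EuclideanSpace ℝ (Fin 3)) :
    |fderiv ℝ u x w| ≤ ‖w‖ * Real.sqrt (∑ j, (fderiv ℝ u x (EuclideanSpace.basisFun (Fin 3) ℝ j)) ^ 2) := by
  set L := fderiv ℝ u x with hL
  -- expand `w` in the standard basis
  have hw : w = ∑ j, w j • EuclideanSpace.basisFun (Fin 3) ℝ j := by
    conv_lhs => rw [← (EuclideanSpace.basisFun (Fin 3) ℝ).sum_repr w]
    simp
  have h1 : L w = ∑ j, w j * L (EuclideanSpace.basisFun (Fin 3) ℝ j) := by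
    conv_lhs => rw [hw]
    simp [map_sum, map_smul, smul_eq_mul]
  rw [h1]
  -- Cauchy–Schwarz for finite sums
  have hcs := Real.sum_mul_le_sqrt_mul_sqrt Finset.univ (fun j => w j) (fun j => L (EuclideanSpace.basisFun (Fin 3) ℝ j))
  have hnorm : Real.sqrt (∑ j, w j ^ 2) = ‖w‖ := by
    rw [EuclideanSpace.norm_eq]; congr 1
    exact Finset.sum_congr rfl fun j _ => by rw [Real.norm_eq_abs, sq_abs]
  have habs : |∑ j, w j * L (EuclideanSpace.basisFun (Fin 3) ℝ j)| ≤ Real.sqrt (∑ j, w j ^ 2) * Real.sqrt (∑ j, (L (EuclideanSpace.basisFun (Fin 3) ℝ j)) ^ 2) := by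
    rw [abs_le]
    constructor
    · have h := Real.sum_mul_le_sqrt_mul_sqrt Finset.univ (fun j => -w j) (fun j => L (EuclideanSpace.basisFun (Fin 3) ℝ j))
      simp only [neg_mul, Finset.sum_neg_distrib, even_two, Even.neg_pow] at h
      linarith
    · exact hcs
  rw [hnorm] at habs
  exact habs

/-- **Componentwise Laplacian inequality for the steady vorticity equation.**  If `Ω ∈ C²` solves `𝒯_UΩ(y) = 0` at `y`, then for each standard basis vector `eᵢ`, with
`u = ⟪Ω, eᵢ⟫` and `v = U + ½y − αe₃×y`:  `|Δu(y)| ≤ ‖v(y)‖·√(Σⱼ(Du(y)[eⱼ])²) + |u(y)| + (|α| + ‖DU(y)‖)·‖Ω(y)‖`. -/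
theorem abs_laplacian_vorticity_component_le (α : ℝ) {U Ω : EuclideanSpace ℝ (Fin 3) → EuclideanSpace ℝ (Fin 3)} (hΩ : ContDiff ℝ 2 Ω)
    {y : EuclideanSpace ℝ (Fin 3)}
    (hvort : α • (cross (EuclideanSpace.single 2 1) (Ω y) - fderiv ℝ Ω y (cross (EuclideanSpace.single 2 1) y)) + Ω y + (1/2:ℝ) • fderiv ℝ Ω y y
        - (Δ Ω) y + fderiv ℝ Ω y (U y) - fderiv ℝ U y (Ω y) = 0) (i : Fin 3) :
    |(Δ (fun z => ⟪Ω z, EuclideanSpace.basisFun (Fin 3) ℝ i⟫_ℝ)) y|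
      ≤ ‖U y + (1/2:ℝ) • y - α • cross (EuclideanSpace.single 2 1) y‖
          * Real.sqrt (∑ j, (fderiv ℝ (fun z => ⟪Ω z, EuclideanSpace.basisFun (Fin 3) ℝ i⟫_ℝ) y (EuclideanSpace.basisFun (Fin 3) ℝ j)) ^ 2)
        + |⟪Ω y, EuclideanSpace.basisFun (Fin 3) ℝ i⟫_ℝ| + (|α| + ‖fderiv ℝ U y‖) * ‖Ω y‖ := by
  set e : EuclideanSpace ℝ (Fin 3) := EuclideanSpace.basisFun (Fin 3) ℝ i with he_def
  have he1 : ‖e‖ = 1 := (EuclideanSpace.basisFun (Fin 3) ℝ).orthonormal.1 i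
  have hΩ1 : Differentiable ℝ Ω := hΩ.differentiable (by norm_num)
  -- `Δu = ⟪ΔΩ, e⟫`, `Du[w] = ⟪DΩ[w], e⟫`
  have hL : (Δ (fun z => ⟪Ω z, e⟫_ℝ)) y = ⟪(Δ Ω) y, e⟫_ℝ := by
    have hc : ContDiff ℝ 2 (fun _ : EuclideanSpace ℝ (Fin 3) => e) := contDiff_const
    rw [laplacian_inner_eq (EuclideanSpace.basisFun (Fin 3) ℝ) hΩ hc y, laplacian_const_eq_zero]
    simp
  have hD : ∀ w, fderiv ℝ (fun z => ⟪Ω z, e⟫_ℝ) y w = ⟪fderiv ℝ Ω y w, e⟫_ℝ := fun w => by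
    rw [fderiv_inner_apply ℝ (hΩ1 y) (differentiableAt_const _) w]; simp
  -- the component equation: `⟪ΔΩ, e⟫ = Du[v] + u + α⟪e₃×Ω, e⟫ − ⟪DU·Ω, e⟫`
  have heq : ⟪(Δ Ω) y, e⟫_ℝ = fderiv ℝ (fun z => ⟪Ω z, e⟫_ℝ) y (U y + (1/2:ℝ) • y - α • cross (EuclideanSpace.single 2 1) y)
      + ⟪Ω y, e⟫_ℝ + α * ⟪cross (EuclideanSpace.single 2 1) (Ω y), e⟫_ℝ - ⟪fderiv ℝ U y (Ω y), e⟫_ℝ := by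
    have h1 : (Δ Ω) y = α • (cross (EuclideanSpace.single 2 1) (Ω y) - fderiv ℝ Ω y (cross (EuclideanSpace.single 2 1) y)) + Ω y
        + (1/2:ℝ) • fderiv ℝ Ω y y + fderiv ℝ Ω y (U y) - fderiv ℝ U y (Ω y) := by
      rw [eq_comm, ← sub_eq_zero, ← hvort]
      abel
    rw [h1, hD]
    simp only [inner_add_left, inner_sub_left, inner_smul_left, map_add, map_sub, map_smul, RCLike.conj_to_real]
    ring
  -- bounds on the three extra terms
  have hrot : |α * ⟪cross (EuclideanSpace.single 2 1) (Ω y), e⟫_ℝ| ≤ |α| * ‖Ω y‖ := by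
    rw [abs_mul]
    refine mul_le_mul_of_nonneg_left ?_ (abs_nonneg α)
    calc |⟪cross (EuclideanSpace.single 2 1) (Ω y), e⟫_ℝ| ≤ ‖cross (EuclideanSpace.single 2 1) (Ω y)‖ * ‖e‖ := abs_real_inner_le_norm _ _
      _ ≤ ‖Ω y‖ * 1 := by rw [he1]; exact mul_le_mul_of_nonneg_right (norm_cross_single_two_le _) zero_le_one
      _ = ‖Ω y‖ := mul_one _
  have hstr : |⟪fderiv ℝ U y (Ω y), e⟫_ℝ| ≤ ‖fderiv ℝ U y‖ * ‖Ω y‖ := by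
    calc |⟪fderiv ℝ U y (Ω y), e⟫_ℝ| ≤ ‖fderiv ℝ U y (Ω y)‖ * ‖e‖ := abs_real_inner_le_norm _ _
      _ ≤ ‖fderiv ℝ U y‖ * ‖Ω y‖ := by rw [he1, mul_one]; exact (fderiv ℝ U y).le_opNorm _
  have hdrift := abs_fderiv_apply_le_norm_mul_sqrt (u := fun z => ⟪Ω z, e⟫_ℝ) y (U y + (1/2:ℝ) • y - α • cross (EuclideanSpace.single 2 1) y)
  rw [hL, heq]
  have t1 := abs_sub (fderiv ℝ (fun z => ⟪Ω z, e⟫_ℝ) y (U y + (1/2:ℝ) • y - α • cross (EuclideanSpace.single 2 1) y) + ⟪Ω y, e⟫_ℝ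
      + α * ⟪cross (EuclideanSpace.single 2 1) (Ω y), e⟫_ℝ) ⟪fderiv ℝ U y (Ω y), e⟫_ℝ
  have t2 := abs_add_three (fderiv ℝ (fun z => ⟪Ω z, e⟫_ℝ) y (U y + (1/2:ℝ) • y - α • cross (EuclideanSpace.single 2 1) y)) ⟪Ω y, e⟫_ℝ
      (α * ⟪cross (EuclideanSpace.single 2 1) (Ω y), e⟫_ℝ)
  have e3 : (|α| + ‖fderiv ℝ U y‖) * ‖Ω y‖ = |α| * ‖Ω y‖ + ‖fderiv ℝ U y‖ * ‖Ω y‖ := by ring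
  linarith

/-- **L² → L^∞ FOR THE STEADY VORTICITY EQUATION (interior, dimension three).**  There is a universal `K > 0` such that: if `U ∈ C¹`, `Ω ∈ C³` solves `𝒯_UΩ = 0` on the closed
ball `B̄(x₀, σ)` with `0 < σ ≤ 1`, the frame field is bounded there by `‖U + ½y − αe₃×y‖ ≤ 1/σ` and `‖DU‖ ≤ D`, then for every `x ∈ B̄(x₀, σ/2)` and every coordinate `i`,
`⟪Ω(x), eᵢ⟫² ≤ K·σ·(σ⁻⁴ + (|α| + D)²)·∫_{B̄(x₀,σ)} ‖Ω‖²`.  (Scaled interior maximum estimate `Literature.Analysis.PDE.ball_estimates_three` applied to the component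
`⟪Ω, eᵢ⟫` with the Laplacian inequality `abs_laplacian_vorticity_component_le`; choose `σ ≤ 1/sup‖v‖` — at the window scale `σ ~ Γ^{-1/2}`, polynomial losses.) -/
theorem vorticity_component_sq_le :
    ∃ K : ℝ, 0 < K ∧ ∀ (α : ℝ) (U Ω : EuclideanSpace ℝ (Fin 3) → EuclideanSpace ℝ (Fin 3)) (x₀ : EuclideanSpace ℝ (Fin 3)) (σ D : ℝ),
      ContDiff ℝ 1 U → ContDiff ℝ 3 Ω → 0 < σ → σ ≤ 1 → 0 ≤ D →
      (∀ y ∈ closedBall x₀ σ, α • (cross (EuclideanSpace.single 2 1) (Ω y) - fderiv ℝ Ω y (cross (EuclideanSpace.single 2 1) y)) + Ω y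
          + (1/2:ℝ) • fderiv ℝ Ω y y - (Δ Ω) y + fderiv ℝ Ω y (U y) - fderiv ℝ U y (Ω y) = 0) →
      (∀ y ∈ closedBall x₀ σ, ‖U y + (1/2:ℝ) • y - α • cross (EuclideanSpace.single 2 1) y‖ ≤ 1 / σ) →
      (∀ y ∈ closedBall x₀ σ, ‖fderiv ℝ U y‖ ≤ D) →
      ∀ x ∈ closedBall x₀ (σ / 2), ∀ i : Fin 3,
        ⟪Ω x, EuclideanSpace.basisFun (Fin 3) ℝ i⟫_ℝ ^ 2
          ≤ K * σ * ((1 / σ) ^ 4 + (|α| + D) ^ 2) * ∫ y in closedBall x₀ σ, ‖Ω y‖ ^ 2 := by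
  obtain ⟨M, hM1, hmain⟩ := Literature.Analysis.PDE.ball_estimates_three (EuclideanSpace.basisFun (Fin 3) ℝ)
  set c : ℝ := 3 * (∫⁻ u in ball (0 : EuclideanSpace ℝ (Fin 3)) 1, RieszKernel.powKer 2 u).toReal / (16 * Real.pi ^ 2) with hc_def
  have hc0 : 0 ≤ c := by have : 0 ≤ (∫⁻ u in ball (0 : EuclideanSpace ℝ (Fin 3)) 1, RieszKernel.powKer 2 u).toReal := ENNReal.toReal_nonneg; positivity
  have hM0 : 0 ≤ M := by linarith
  refine ⟨(c + 1) * (46000 * 64 * M ^ 4 + 1600), by positivity, ?_⟩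
  intro α U Ω x₀ σ D hU hΩ hσ hσ1 hD hvort hv hDU x hx i
  have hΩ2 : ContDiff ℝ 2 Ω := hΩ.of_le (by norm_num)
  set e : EuclideanSpace ℝ (Fin 3) := EuclideanSpace.basisFun (Fin 3) ℝ i with he_def
  have he1 : ‖e‖ = 1 := (EuclideanSpace.basisFun (Fin 3) ℝ).orthonormal.1 i
  set u : EuclideanSpace ℝ (Fin 3) → ℝ := fun z => ⟪Ω z, e⟫_ℝ with hu_def
  set G : EuclideanSpace ℝ (Fin 3) → ℝ := fun z => (|α| + D) * ‖Ω z‖ with hG_def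
  have hu3 : ContDiffOn ℝ 3 u Set.univ := (hΩ.inner ℝ contDiff_const).contDiffOn
  have hG : Continuous G := continuous_const.mul hΩ.continuous.norm
  have hMσ : 1 / σ ≤ M / σ := div_le_div_of_nonneg_right hM1 hσ.le
  have hMσ1 : 1 ≤ M / σ := by rw [le_div_iff₀ hσ]; linarith
  -- the Laplacian inequality in the tree lemma's form (ε = 0)
  have hΔ : ∀ y ∈ closedBall x₀ σ, |(Δ u) y| ≤
      0 * Real.sqrt (∑ i', ∑ j, (fderiv ℝ (fun z => fderiv ℝ u z (EuclideanSpace.basisFun (Fin 3) ℝ i')) y (EuclideanSpace.basisFun (Fin 3) ℝ j)) ^ 2)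
        + M / σ * Real.sqrt (∑ j, (fderiv ℝ u y (EuclideanSpace.basisFun (Fin 3) ℝ j)) ^ 2) + (M / σ) ^ 2 * |u y| + G y := by
    intro y hy
    have h := abs_laplacian_vorticity_component_le α (U := U) hΩ2 (hvort y hy) i
    have hS : 0 ≤ Real.sqrt (∑ j, (fderiv ℝ u y (EuclideanSpace.basisFun (Fin 3) ℝ j)) ^ 2) := Real.sqrt_nonneg _
    have h1 : ‖U y + (1/2:ℝ) • y - α • cross (EuclideanSpace.single 2 1) y‖ * Real.sqrt (∑ j, (fderiv ℝ u y (EuclideanSpace.basisFun (Fin 3) ℝ j)) ^ 2)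
        ≤ M / σ * Real.sqrt (∑ j, (fderiv ℝ u y (EuclideanSpace.basisFun (Fin 3) ℝ j)) ^ 2) :=
      mul_le_mul_of_nonneg_right ((hv y hy).trans hMσ) hS
    have h2 : |u y| ≤ (M / σ) ^ 2 * |u y| := by
      have : 1 ≤ (M / σ) ^ 2 := by nlinarith
      nlinarith [abs_nonneg (u y)]
    have h3 : (|α| + ‖fderiv ℝ U y‖) * ‖Ω y‖ ≤ G y := by
      simp only [hG_def]
      exact mul_le_mul_of_nonneg_right (by linarith [hDU y hy]) (norm_nonneg _)
    simp only [hu_def] at h h1 h2 ⊢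
    linarith
  have key := (hmain Set.univ u G x₀ σ 0 isOpen_univ (Set.subset_univ _) hu3 hσ le_rfl (by norm_num) hG hΔ).2.2 x hx
  -- the two integrals on the right
  have hK : IsCompact (closedBall x₀ σ) := isCompact_closedBall x₀ σ
  have hIΩ : IntegrableOn (fun y => ‖Ω y‖ ^ 2) (closedBall x₀ σ) := (hΩ.continuous.norm.pow 2).continuousOn.integrableOn_compact hK
  have hIu : IntegrableOn (fun y => u y ^ 2) (closedBall x₀ σ) := ((hΩ.continuous.inner continuous_const).pow 2).continuousOn.integrableOn_compact hK
  have hu_le : (∫ y in closedBall x₀ σ, u y ^ 2) ≤ ∫ y in closedBall x₀ σ, ‖Ω y‖ ^ 2 := by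
    refine setIntegral_mono_on hIu hIΩ measurableSet_closedBall fun y _ => ?_
    have h1 : |u y| ≤ ‖Ω y‖ := by
      calc |u y| ≤ ‖Ω y‖ * ‖e‖ := abs_real_inner_le_norm _ _
        _ = ‖Ω y‖ := by rw [he1, mul_one]
    calc u y ^ 2 = |u y| ^ 2 := (sq_abs _).symm
      _ ≤ ‖Ω y‖ ^ 2 := pow_le_pow_left₀ (abs_nonneg _) h1 2
  have hG_eq : (∫ y in closedBall x₀ σ, G y ^ 2) = (|α| + D) ^ 2 * ∫ y in closedBall x₀ σ, ‖Ω y‖ ^ 2 := by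
    simp only [hG_def, mul_pow]
    exact integral_const_mul _ _
  have hI0 : 0 ≤ ∫ y in closedBall x₀ σ, ‖Ω y‖ ^ 2 := setIntegral_nonneg measurableSet_closedBall fun y _ => by positivity
  -- bookkeeping of constants
  have hcard : ((Fintype.card (Fin 3) : ℝ) + 1) = 4 := by norm_num
  rw [hcard, hG_eq] at key
  have hu_x : u x = ⟪Ω x, EuclideanSpace.basisFun (Fin 3) ℝ i⟫_ℝ := rfl
  rw [← hu_x]
  set I := ∫ y in closedBall x₀ σ, ‖Ω y‖ ^ 2 with hI
  have hσ4 : (M / σ) ^ 4 = M ^ 4 * (1 / σ) ^ 4 := by rw [div_pow, div_pow, one_pow]; ring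
  have hA0 : 0 ≤ (1 / σ) ^ 4 := by positivity
  have hB0 : 0 ≤ (|α| + D) ^ 2 := by positivity
  calc u x ^ 2 ≤ c * σ * (46000 * (4:ℝ) ^ 3 * (M / σ) ^ 4 * (∫ y in closedBall x₀ σ, u y ^ 2) + 400 * 4 * ((|α| + D) ^ 2 * I)) := key
    _ ≤ c * σ * (46000 * (4:ℝ) ^ 3 * (M / σ) ^ 4 * I + 400 * 4 * ((|α| + D) ^ 2 * I)) := by
        have : 46000 * (4:ℝ) ^ 3 * (M / σ) ^ 4 * (∫ y in closedBall x₀ σ, u y ^ 2) ≤ 46000 * (4:ℝ) ^ 3 * (M / σ) ^ 4 * I :=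
          mul_le_mul_of_nonneg_left hu_le (by positivity)
        have hcσ : 0 ≤ c * σ := by positivity
        nlinarith
    _ = c * σ * ((46000 * 64 * M ^ 4) * (1 / σ) ^ 4 + 1600 * (|α| + D) ^ 2) * I := by rw [hσ4]; ring
    _ ≤ (c + 1) * (46000 * 64 * M ^ 4 + 1600) * σ * ((1 / σ) ^ 4 + (|α| + D) ^ 2) * I := by
        have h1 : (46000 * 64 * M ^ 4) * (1 / σ) ^ 4 + 1600 * (|α| + D) ^ 2 ≤ (46000 * 64 * M ^ 4 + 1600) * ((1 / σ) ^ 4 + (|α| + D) ^ 2) := by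
          nlinarith [pow_nonneg hM0 4]
        have h2 : c * σ ≤ (c + 1) * σ := by nlinarith
        have h3 : 0 ≤ (46000 * 64 * M ^ 4) * (1 / σ) ^ 4 + 1600 * (|α| + D) ^ 2 := by positivity
        calc c * σ * ((46000 * 64 * M ^ 4) * (1 / σ) ^ 4 + 1600 * (|α| + D) ^ 2) * I
            ≤ (c + 1) * σ * ((46000 * 64 * M ^ 4 + 1600) * ((1 / σ) ^ 4 + (|α| + D) ^ 2)) * I := by
              apply mul_le_mul_of_nonneg_right _ hI0
              exact mul_le_mul h2 h1 h3 (by positivity)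
          _ = (c + 1) * (46000 * 64 * M ^ 4 + 1600) * σ * ((1 / σ) ^ 4 + (|α| + D) ^ 2) * I := by ring

end Summit.NavierStokesRegularity.NavierStokesRegularity.Theorems.DefectColumnGate

end
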